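import Summits.QuantumFields.YangMills.Theorems.FluctuationComparisonRegPrIntLOrganTangentFibreMeanSquareKnit
import HarnessLib

/-!
# Crux `FluctuationComparisonRegPrIntL` (stmt-QuantumFields-20520, rung R3), PATH-B v18 organ O1ᵘ-H v2, JENSEN SIDE (JVARᵘ-H road):
# **THE VARIANCE SQUARE KNIT** — the exact four-channel identity for the second difference of a FIBRE VARIANCE over a square of data,
# the Jensen-side twin of LEAD w3 g25's ✓BRICK 2b `…OrganTangentFibreMeanSquareKnit.fibreMean_secondDiff_eq` (which it imports and applies BY NAME)

Cell `ym3-torus` (rung R3 = continuum `SU(2)` Yang–Mills on T³ — NOT d = 4, NOT infinite volume, NOT a mass gap, NOT Clay), width copy `ym3-torus-px5` (gen 19;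
INTENT 03:39Z, LEAD w3 g25 first refusal).  `--kind proof --supports stmt-QuantumFields-20520 --as helper`, count-neutral, DEFINITION-FREE, default heartbeats,
`autoImplicit false`; THEOREMS ONLY on ONE abstract fibre `(Ω, P)`; no registry ∕ binder ∕ `Lines/` edit.

WHY.  JVARᵘ-H (✓p805394's hypothesis; the Jensen side of BRICK 1 ✓p804070) is a one-bond-pair MIXED-DIFFERENCE clause, in the conditioning datum, for
`A_t(V) = Var[h_{Ts}; ŵ_{V,t}]`, the variance of the SEED discrepancy under the (tilted) m-step fibre law.  On one abstract fibre, the four corners of a datum square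
read `v_ab = ∫ (F_ab − m_ab)²·ŵ_ab dP` (`F_ab = h_{Ts}∘T_{V_ab}`, `ŵ_ab` the normalised — possibly tilted — weights, `m_ab` ANY centring constants, in the consumer
the `ŵ_ab`-means).  This file proves, with NO analysis:
* §1 `sq_secondDiff_eq` — `d² − b² − c² + a² = (d − b − c + a)·(d + b + c − a) + 2·((b − a)·(c − a))` (the square's algebra);
* §2 ★★`fibreVar_secondDiff_eq` — ✓`fibreMean_secondDiff_eq` at `G_ab := (F_ab − m_ab)²` composed with §1 and the difference of squares:
  `ΔΔ v = ∫ (ΔΔF − ΔΔm)·(u₁₁ + u₁₀ + u₀₁ − u₀₀)·ŵ₁₁ + 2·∫ (Δ₁F − Δ₁m)·(Δ₂F − Δ₂m)·ŵ₁₁`  (PULL-BACK ×2: the MEAN's second∕first differences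
  `ΔΔm, Δᵢm` — BRICK 2b's object — re-enter pointwise, so the Jensen side sits literally on top of LIN's)
  `+ ∫ ((Δ₁F − Δ₁m)·(u₁₀ + u₀₀) − c₁)·(ŵ₁₁ − ŵ₁₀) + ∫ ((Δ₂F − Δ₂m)·(u₀₁ + u₀₀) − c₂)·(ŵ₁₁ − ŵ₀₁)`  (CROSS ×2, pinned leg `ΔᵢF − Δᵢm` explicit)
  `+ ∫ (u₀₀² − c₀)·(ŵ₁₁ − ŵ₁₀ − ŵ₀₁ + ŵ₀₀)`  (CENTRED), `u_ab := F_ab − m_ab`, EXACT for any `c₁ c₂ c₀`.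
The TILT is an INSTANCE of the weights (the consumer feeds `ŵ_{ab,t} ∝ e^{t·F_ab}·ŵ_ab`), so the identity serves `A_t` for every `t` verbatim.  The m-uniform
READING (px5 g19 03:28Z ∕ ideator g27 №15 TN-COV-3 ∕ g28 №1: per-piece TRUNCATED-CORRELATION slots of order ≤ 3 for `F = Σ_p c_p·f_p`, NO global `√Var`) is the
follow-up §3 on ideator g28's `FibreLawH` (κ₂)(κ₃) texts — not here.

HONEST FRAMING: an integral identity over HYPOTHESIS data ([folklore]); transports ∕ weights ∕ letters for the runs NOT constructed; nothing of Bałaban's analysis is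
asserted or proved; JVARᵘ-H, LINᵘ-H, O1ᵘ-H v2, S1aᴴ, crux 20520, `YM3TorusSU2` are NOT proved; registry `Lines/semiclassical_s2beta.lean` v11.4 (★★OWNER RULING
№36) and `Lines/runpair_organ.lean` untouched, nothing here is registered; rung R3 = SU(2) YM₃ on T³ — NOT d = 4, NOT infinite volume, NOT a mass gap, NOT Clay; the
Yang–Mills mass gap is NOT proved by any of this.  Credit: LEAD w3 g25 (2b's identity and binder style, reused by name).
-/

set_option autoImplicit false

noncomputable section

namespace Summit.QuantumFields.YangMills.Theorems.FluctuationComparisonRegPrIntLOrganTangentFibreVarianceSquareKnit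

open MeasureTheory
open Summit.QuantumFields.YangMills.Theorems.OrganTangentFibreMeanSquareKnit (integrable_bdd_mul fibreMean_secondDiff_eq)

variable {Ω : Type*} [MeasurableSpace Ω]

/-! ## §1 The square's algebra -/

/-- Second difference of squares over a square of four numbers: `d² − b² − c² + a² = (d − b − c + a)·(d + b + c − a) + 2·((b − a)·(c − a))`. [folklore] -/
theorem sq_secondDiff_eq (a b c d : ℝ) :
    d ^ 2 - b ^ 2 - c ^ 2 + a ^ 2 = (d - b - c + a) * (d + b + c - a) + 2 * ((b - a) * (c - a)) := by
  ring

/-- A centred bounded observable is bounded: `|F ξ| ≤ M ⇒ |(F ξ − m)²| ≤ (M + |m|)²`. [folklore] -/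
theorem abs_sq_sub_le {x M m : ℝ} (hx : |x| ≤ M) : |(x - m) ^ 2| ≤ (M + |m|) ^ 2 := by
  rw [abs_pow, sq_abs, ← sq_abs (x - m)]
  have h1 : |x - m| ≤ M + |m| := (abs_sub x m).trans (add_le_add hx le_rfl)
  exact pow_le_pow_left₀ (abs_nonneg _) h1 2

/-! ## §2 The variance square knit -/

/-- ★★ **THE VARIANCE SQUARE KNIT** (exact identity, any centring constants `m_ab` and `c₁ c₂ c₀`; see the module docstring): the second difference over a
square of data of the fibre variances `v_ab = ∫ (F_ab − m_ab)²·ŵ_ab` splits into PULL-BACK ×2 (the observable's second difference minus the MEAN's, paired with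
the centred sum; twice the product of the two centred first differences), CROSS ×2 (pinned first difference × centred sum, against the weight's first
variation) and CENTRED (base square against the weight's second variation) — ✓`fibreMean_secondDiff_eq` at `G_ab := (F_ab − m_ab)²` ∘ `sq_secondDiff_eq`. [folklore] -/
theorem fibreVar_secondDiff_eq (P : Measure Ω)
    (F₀₀ F₁₀ F₀₁ F₁₁ w₀₀ w₁₀ w₀₁ w₁₁ : Ω → ℝ) (M m₀₀ m₁₀ m₀₁ m₁₁ c₁ c₂ c₀ : ℝ)
    (hF₀₀ : AEStronglyMeasurable F₀₀ P) (hF₁₀ : AEStronglyMeasurable F₁₀ P)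
    (hF₀₁ : AEStronglyMeasurable F₀₁ P) (hF₁₁ : AEStronglyMeasurable F₁₁ P)
    (hb₀₀ : ∀ ξ, |F₀₀ ξ| ≤ M) (hb₁₀ : ∀ ξ, |F₁₀ ξ| ≤ M) (hb₀₁ : ∀ ξ, |F₀₁ ξ| ≤ M) (hb₁₁ : ∀ ξ, |F₁₁ ξ| ≤ M)
    (hw₀₀ : Integrable w₀₀ P) (hw₁₀ : Integrable w₁₀ P) (hw₀₁ : Integrable w₀₁ P) (hw₁₁ : Integrable w₁₁ P)
    (hn₀₀ : ∫ ξ, w₀₀ ξ ∂P = 1) (hn₁₀ : ∫ ξ, w₁₀ ξ ∂P = 1) (hn₀₁ : ∫ ξ, w₀₁ ξ ∂P = 1) (hn₁₁ : ∫ ξ, w₁₁ ξ ∂P = 1) :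
    (∫ ξ, (F₁₁ ξ - m₁₁) ^ 2 * w₁₁ ξ ∂P) - (∫ ξ, (F₁₀ ξ - m₁₀) ^ 2 * w₁₀ ξ ∂P) - (∫ ξ, (F₀₁ ξ - m₀₁) ^ 2 * w₀₁ ξ ∂P)
        + (∫ ξ, (F₀₀ ξ - m₀₀) ^ 2 * w₀₀ ξ ∂P)
      = (∫ ξ, ((F₁₁ ξ - F₁₀ ξ - F₀₁ ξ + F₀₀ ξ) - (m₁₁ - m₁₀ - m₀₁ + m₀₀))
            * ((F₁₁ ξ - m₁₁) + (F₁₀ ξ - m₁₀) + (F₀₁ ξ - m₀₁) - (F₀₀ ξ - m₀₀)) * w₁₁ ξ ∂P)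
        + 2 * (∫ ξ, ((F₁₀ ξ - F₀₀ ξ) - (m₁₀ - m₀₀)) * ((F₀₁ ξ - F₀₀ ξ) - (m₀₁ - m₀₀)) * w₁₁ ξ ∂P)
        + (∫ ξ, (((F₁₀ ξ - F₀₀ ξ) - (m₁₀ - m₀₀)) * ((F₁₀ ξ - m₁₀) + (F₀₀ ξ - m₀₀)) - c₁) * (w₁₁ ξ - w₁₀ ξ) ∂P)
        + (∫ ξ, (((F₀₁ ξ - F₀₀ ξ) - (m₀₁ - m₀₀)) * ((F₀₁ ξ - m₀₁) + (F₀₀ ξ - m₀₀)) - c₂) * (w₁₁ ξ - w₀₁ ξ) ∂P)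
        + (∫ ξ, ((F₀₀ ξ - m₀₀) ^ 2 - c₀) * (w₁₁ ξ - w₁₀ ξ - w₀₁ ξ + w₀₀ ξ) ∂P) := by
  -- the squared centred observables are bounded by one constant
  set S : ℝ := |m₀₀| + |m₁₀| + |m₀₁| + |m₁₁| with hS
  have hS₀₀ : |m₀₀| ≤ S := by rw [hS]; linarith only [abs_nonneg m₁₀, abs_nonneg m₀₁, abs_nonneg m₁₁]
  have hS₁₀ : |m₁₀| ≤ S := by rw [hS]; linarith only [abs_nonneg m₀₀, abs_nonneg m₀₁, abs_nonneg m₁₁]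
  have hS₀₁ : |m₀₁| ≤ S := by rw [hS]; linarith only [abs_nonneg m₀₀, abs_nonneg m₁₀, abs_nonneg m₁₁]
  have hS₁₁ : |m₁₁| ≤ S := by rw [hS]; linarith only [abs_nonneg m₀₀, abs_nonneg m₁₀, abs_nonneg m₀₁]
  have hbd : ∀ {F : Ω → ℝ} {m : ℝ}, (∀ ξ, |F ξ| ≤ M) → |m| ≤ S → ∀ ξ, |(fun ξ => (F ξ - m) ^ 2) ξ| ≤ (M + S) ^ 2 := by
    intro F m hF hm ξ
    have hM : 0 ≤ M := (abs_nonneg _).trans (hF ξ)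
    refine (abs_sq_sub_le (hF ξ)).trans ?_
    exact pow_le_pow_left₀ (by positivity) (add_le_add le_rfl hm) 2
  have hms : ∀ {F : Ω → ℝ} (m : ℝ), AEStronglyMeasurable F P → AEStronglyMeasurable (fun ξ => (F ξ - m) ^ 2) P :=
    fun m hF => (hF.sub aestronglyMeasurable_const).pow 2
  -- BRICK 2b's identity for `G_ab := (F_ab − m_ab)²`
  have key := fibreMean_secondDiff_eq P (fun ξ => (F₀₀ ξ - m₀₀) ^ 2) (fun ξ => (F₁₀ ξ - m₁₀) ^ 2)
    (fun ξ => (F₀₁ ξ - m₀₁) ^ 2) (fun ξ => (F₁₁ ξ - m₁₁) ^ 2) w₀₀ w₁₀ w₀₁ w₁₁ ((M + S) ^ 2) c₁ c₂ c₀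
    (hms m₀₀ hF₀₀) (hms m₁₀ hF₁₀) (hms m₀₁ hF₀₁) (hms m₁₁ hF₁₁)
    (hbd hb₀₀ hS₀₀) (hbd hb₁₀ hS₁₀) (hbd hb₀₁ hS₀₁) (hbd hb₁₁ hS₁₁)
    hw₀₀ hw₁₀ hw₀₁ hw₁₁ hn₀₀ hn₁₀ hn₀₁ hn₁₁
  rw [key]
  -- the PULL-BACK integrand splits by `sq_secondDiff_eq`
  have hM4 : ∀ ξ, |(F₁₁ ξ - F₁₀ ξ - F₀₁ ξ + F₀₀ ξ) - (m₁₁ - m₁₀ - m₀₁ + m₀₀)| ≤ 4 * M + 4 * S := by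
    intro ξ
    have h1 := abs_le.mp (hb₁₁ ξ); have h2 := abs_le.mp (hb₁₀ ξ); have h3 := abs_le.mp (hb₀₁ ξ); have h4 := abs_le.mp (hb₀₀ ξ)
    have h5 := abs_le.mp hS₁₁; have h6 := abs_le.mp hS₁₀; have h7 := abs_le.mp hS₀₁; have h8 := abs_le.mp hS₀₀
    rw [abs_le]; constructor <;> linarith only [h1.1, h1.2, h2.1, h2.2, h3.1, h3.2, h4.1, h4.2, h5.1, h5.2, h6.1, h6.2, h7.1, h7.2, h8.1, h8.2]
  have hSum : ∀ ξ, |(F₁₁ ξ - m₁₁) + (F₁₀ ξ - m₁₀) + (F₀₁ ξ - m₀₁) - (F₀₀ ξ - m₀₀)| ≤ 4 * M + 4 * S := by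
    intro ξ
    have h1 := abs_le.mp (hb₁₁ ξ); have h2 := abs_le.mp (hb₁₀ ξ); have h3 := abs_le.mp (hb₀₁ ξ); have h4 := abs_le.mp (hb₀₀ ξ)
    have h5 := abs_le.mp hS₁₁; have h6 := abs_le.mp hS₁₀; have h7 := abs_le.mp hS₀₁; have h8 := abs_le.mp hS₀₀
    rw [abs_le]; constructor <;> linarith only [h1.1, h1.2, h2.1, h2.2, h3.1, h3.2, h4.1, h4.2, h5.1, h5.2, h6.1, h6.2, h7.1, h7.2, h8.1, h8.2]
  have hD₁ : ∀ ξ, |(F₁₀ ξ - F₀₀ ξ) - (m₁₀ - m₀₀)| ≤ 4 * M + 4 * S := by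
    intro ξ
    have h2 := abs_le.mp (hb₁₀ ξ); have h4 := abs_le.mp (hb₀₀ ξ); have h6 := abs_le.mp hS₁₀; have h8 := abs_le.mp hS₀₀
    have hM : 0 ≤ M := (abs_nonneg _).trans (hb₀₀ ξ)
    have hS0 : 0 ≤ S := (abs_nonneg _).trans hS₀₀
    rw [abs_le]; constructor <;> linarith only [h2.1, h2.2, h4.1, h4.2, h6.1, h6.2, h8.1, h8.2, hM, hS0]
  have hD₂ : ∀ ξ, |(F₀₁ ξ - F₀₀ ξ) - (m₀₁ - m₀₀)| ≤ 4 * M + 4 * S := by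
    intro ξ
    have h3 := abs_le.mp (hb₀₁ ξ); have h4 := abs_le.mp (hb₀₀ ξ); have h7 := abs_le.mp hS₀₁; have h8 := abs_le.mp hS₀₀
    have hM : 0 ≤ M := (abs_nonneg _).trans (hb₀₀ ξ)
    have hS0 : 0 ≤ S := (abs_nonneg _).trans hS₀₀
    rw [abs_le]; constructor <;> linarith only [h3.1, h3.2, h4.1, h4.2, h7.1, h7.2, h8.1, h8.2, hM, hS0]
  have hprod : ∀ {a b : Ω → ℝ} {K : ℝ}, (∀ ξ, |a ξ| ≤ K) → (∀ ξ, |b ξ| ≤ K) → ∀ ξ, |a ξ * b ξ| ≤ K * K := by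
    intro a b K ha hb ξ
    rw [abs_mul]
    exact mul_le_mul (ha ξ) (hb ξ) (abs_nonneg _) ((abs_nonneg _).trans (ha ξ))
  have mΔΔ : AEStronglyMeasurable (fun ξ => (F₁₁ ξ - F₁₀ ξ - F₀₁ ξ + F₀₀ ξ) - (m₁₁ - m₁₀ - m₀₁ + m₀₀)) P :=
    (((hF₁₁.sub hF₁₀).sub hF₀₁).add hF₀₀).sub aestronglyMeasurable_const
  have mSum : AEStronglyMeasurable (fun ξ => (F₁₁ ξ - m₁₁) + (F₁₀ ξ - m₁₀) + (F₀₁ ξ - m₀₁) - (F₀₀ ξ - m₀₀)) P :=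
    (((hF₁₁.sub aestronglyMeasurable_const).add (hF₁₀.sub aestronglyMeasurable_const)).add
      (hF₀₁.sub aestronglyMeasurable_const)).sub (hF₀₀.sub aestronglyMeasurable_const)
  have mD₁ : AEStronglyMeasurable (fun ξ => (F₁₀ ξ - F₀₀ ξ) - (m₁₀ - m₀₀)) P := (hF₁₀.sub hF₀₀).sub aestronglyMeasurable_const
  have mD₂ : AEStronglyMeasurable (fun ξ => (F₀₁ ξ - F₀₀ ξ) - (m₀₁ - m₀₀)) P := (hF₀₁.sub hF₀₀).sub aestronglyMeasurable_const
  have iA := integrable_bdd_mul (mΔΔ.mul mSum) (hprod hM4 hSum) hw₁₁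
  have iB := integrable_bdd_mul (mD₁.mul mD₂) (hprod hD₁ hD₂) hw₁₁
  have e1 : (∫ ξ, ((F₁₁ ξ - m₁₁) ^ 2 - (F₁₀ ξ - m₁₀) ^ 2 - (F₀₁ ξ - m₀₁) ^ 2
        + (F₀₀ ξ - m₀₀) ^ 2) * w₁₁ ξ ∂P)
      = (∫ ξ, ((F₁₁ ξ - F₁₀ ξ - F₀₁ ξ + F₀₀ ξ) - (m₁₁ - m₁₀ - m₀₁ + m₀₀))
            * ((F₁₁ ξ - m₁₁) + (F₁₀ ξ - m₁₀) + (F₀₁ ξ - m₀₁) - (F₀₀ ξ - m₀₀)) * w₁₁ ξ ∂P)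
        + 2 * (∫ ξ, ((F₁₀ ξ - F₀₀ ξ) - (m₁₀ - m₀₀)) * ((F₀₁ ξ - F₀₀ ξ) - (m₀₁ - m₀₀)) * w₁₁ ξ ∂P) := by
    have h : (fun ξ => ((F₁₁ ξ - m₁₁) ^ 2 - (F₁₀ ξ - m₁₀) ^ 2 - (F₀₁ ξ - m₀₁) ^ 2
          + (F₀₀ ξ - m₀₀) ^ 2) * w₁₁ ξ)
        = fun ξ => ((F₁₁ ξ - F₁₀ ξ - F₀₁ ξ + F₀₀ ξ) - (m₁₁ - m₁₀ - m₀₁ + m₀₀))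
            * ((F₁₁ ξ - m₁₁) + (F₁₀ ξ - m₁₀) + (F₀₁ ξ - m₀₁) - (F₀₀ ξ - m₀₀)) * w₁₁ ξ
          + 2 * (((F₁₀ ξ - F₀₀ ξ) - (m₁₀ - m₀₀)) * ((F₀₁ ξ - F₀₀ ξ) - (m₀₁ - m₀₀)) * w₁₁ ξ) := by
      funext ξ; ring
    rw [h, integral_add ?_ ?_, integral_const_mul]
    · simpa [mul_assoc] using iA
    · have := iB.const_mul 2
      refine this.congr (Filter.Eventually.of_forall fun ξ => ?_)
      simp only [Pi.mul_apply, mul_assoc]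
  have e2 : (∫ ξ, ((F₁₀ ξ - m₁₀) ^ 2 - (F₀₀ ξ - m₀₀) ^ 2 - c₁) * (w₁₁ ξ - w₁₀ ξ) ∂P)
      = (∫ ξ, (((F₁₀ ξ - F₀₀ ξ) - (m₁₀ - m₀₀)) * ((F₁₀ ξ - m₁₀) + (F₀₀ ξ - m₀₀)) - c₁) * (w₁₁ ξ - w₁₀ ξ) ∂P) := by
    refine integral_congr_ae (Filter.Eventually.of_forall fun ξ => ?_)
    ring
  have e3 : (∫ ξ, ((F₀₁ ξ - m₀₁) ^ 2 - (F₀₀ ξ - m₀₀) ^ 2 - c₂) * (w₁₁ ξ - w₀₁ ξ) ∂P)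
      = (∫ ξ, (((F₀₁ ξ - F₀₀ ξ) - (m₀₁ - m₀₀)) * ((F₀₁ ξ - m₀₁) + (F₀₀ ξ - m₀₀)) - c₂) * (w₁₁ ξ - w₀₁ ξ) ∂P) := by
    refine integral_congr_ae (Filter.Eventually.of_forall fun ξ => ?_)
    ring
  rw [e1, e2, e3]

end Summit.QuantumFields.YangMills.Theorems.FluctuationComparisonRegPrIntLOrganTangentFibreVarianceSquareKnit

end
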